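import Summits.CriticalPhenomena.PercolationContinuityZ3.Theorems.Transplant.SkelFrmBParamsSlotsST
import Summits.CriticalPhenomena.PercolationContinuityZ3.Theorems.Transplant.SkelFrmBChoiceRadii
import HarnessLib

/-!
(R-40) `…T` TWIN (stmt-g21, 2026-08-23; ruling p3-g16 06:23:56Z, J18; lead g11 06:35:07Z: the choice function of record moves to `frmChoiceAllQ3T`): the twin of
`SkelFrmBChoiceRadii` over the PER-AXIS-capped staggered cells `NegB.fcellsT : PCells2T` / the column slot `offNT` / the schedule `schedOfT` / the scheme `ΓQT` / the choices
`choiceAtQ3T` (SkelFrmBChoiceDefsT); statements and proofs VERBATIM with the S ↦ T tokens of record (stmt's table + hp-8 g42's registry renamedT.txt); the CELL-FREE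
declarations of `SkelFrmBChoiceRadii` are NOT re-declared (they serve the T function as landed — `SkelFrmBChoiceRadii` is imported); NO landed file is edited.

# N2 (frames-only node `SamePDropOfSkeletonFrm₁`, OPEN), WAVE 1 ROOM ROWS, part (b) continued: THE RADIUS ROWS AT THE SCHEDULE OF RECORD `schedOfT … c (SUS ex mx …)` —
# every window radius dominates `E₀`, grows linearly in the cell index, and every residual floor `X + 1 ≤ ex` is a floor on every radius (FRM-PARAMS (r13-20))

The (C) residue / the root leg / the (F) keystone take a per-cell corridor window `(w₀, R, r, Rl) := (t, R, r, Rl)` with the rows `Pk.r₀ ≤ R` (`hR`), `R₁ ≤ R − L′` (KGExcess),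
`D₀ + (kq+3)·‖z‖₁ ≤ R` on the corridor prism (KGDepth, `D₀ := cOffS·‖x‖₁ + 1` = `colVT_mem_graphBall_lin`), and `R ≤` the habitat windows' radii `rB/rQ/rE/ρ` so that
`B_G(t, R)` lands in the habitat.  At a run pair `R := (schedOfT …).rQ α x = Erad (nQ α x)` (p5's `reach_radii_concSG₂NT`); this file serves the VALUE side: for the block of
record `SUS ex mx` every radius is `≥ E₀ (SUS …) ≥ ex + …`, and `rQ α x ≥ E₀ + cOffS·nQ α x ≥ E₀ + cOffS·‖x‖₁` at run pairs — so each of the rows above is discharged by a floor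
`X + 1 ≤ ex` on the residual slot `ex` (the same device as N1's `ex_le_Rπ`), to be collected in the node file's `exR`.
* §1 (any block `Sv`): `E₀_le_rQ_T`, `E₀_le_rB_T`, `E₀_le_rM_T`, `Erad_le_rQ_T`; §2 (at `SUS`): `lin_le_rQ_UT` (`E₀ + cOffS·k ≤ rQ a x` for `k ≤ nQ a x`), `le_rQ_of_le_exT`,
  `le_rB_of_le_exT`, `le_rM_of_le_exT`, **`depth_row_UT`** (`‖x‖₁ ≤ nQ a x → Z + 1 ≤ ex → (cOffS·‖x‖₁ + 1) + Z ≤ rQ a x`), **`sub_row_UT`** (`X + L′ + 1 ≤ E₀ → X ≤ rQ a x − L′`).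
builds on p205010 (kernel theorem, internal audit signed; external expert review pending) — nothing in this file uses p205010; NOTHING is claimed about the open node
`SamePDropOfSkeletonFrm₁` (`SamePDropOfSkeletonNeg₁` is CLOSED in the tree and untouched by this file).
Lane `prim-bschramm`, seat `prim-bschramm-stmt` (gen 20); helper file (`--supports stmt-CriticalPhenomena-4575 --as helper`); FRM-PARAMS (r13-20).
[cite: KozmaNitzan2024, §4 Theorem 6 (pp. 25–31): the order of constants; p. 31 (Step IV: the radii)] [cite: MartineauTassion2017, §4.3]
-/

noncomputable section

open scoped Classical

namespace Summit.CriticalPhenomena.PercolationContinuityZ3.Theorems.Transplant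

namespace PlanarSkeletonFrm

namespace NegB

open Literature.Probability.Percolation Literature.Probability.LatticeModels SimpleGraph
open SkelConc (Consts)
open BoxProdZ2 (ConcRadiiG Erad Frad nQ)
open Neg

/-! ## §1 Every radius of the schedule of record dominates `E₀` (any block) -/

section AnyBlock

variable (κ : Consts) {V : Type} [DecidableEq V] [Countable V] {G : SimpleGraph V} [G.LocallyFinite] (Φ : PlanarSkeletonFrm G) (t : V)
  (p : unitInterval) (D : Skelφ.StepI.DataNS V) (g f : ℕ) (c : Fin 2 → ℕ) (S : Skelφ.Prm.SchedIn)

/-- `E (nQ a x) ≤ rQ a x`. [folklore] -/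
theorem Erad_le_rQ_T (a : ℕ) (x : Site 2) :
    Erad (Skelφ.Prm.gap S) (fun _ => 0) (Skelφ.Prm.E₀ S) (nQ a x) ≤ (schedOfT κ Φ t p D g f c S).rQ a x :=
  Skelφ.Erad_le_rQN _ _ _ _ _ _ a x

/-- **`E₀ ≤ rQ a x`**. [folklore] -/
theorem E₀_le_rQ_T (a : ℕ) (x : Site 2) : Skelφ.Prm.E₀ S ≤ (schedOfT κ Φ t p D g f c S).rQ a x :=
  le_trans (Skel.E₀_le_Erad _ _ _ _) (Erad_le_rQ_T κ Φ t p D g f c S a x)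

/-- **`E₀ ≤ rB a v δ`** (`rB = E (nQ a (v+δ))`). [folklore] -/
theorem E₀_le_rB_T (a : ℕ) (v : Site 2) (δ : MDir) : Skelφ.Prm.E₀ S ≤ (schedOfT κ Φ t p D g f c S).rB a v δ := by
  show _ ≤ Erad (Skelφ.Prm.gap S) (fun _ => 0) (Skelφ.Prm.E₀ S) (nQ a (v + stepVec δ))
  exact Skel.E₀_le_Erad _ _ _ _

/-- **`E₀ ≤ rM a x + L′`** (`rM = F (nQ a x) − L′`, `F ≥ E₀`). [folklore] -/
theorem E₀_le_rM_T (a : ℕ) (x : Site 2) : Skelφ.Prm.E₀ S ≤ (schedOfT κ Φ t p D g f c S).rM a x + Skelφ.Prm.Lp S := by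
  show _ ≤ Frad (Skelφ.Prm.gap S) (fun _ => 0) (Skelφ.Prm.E₀ S) (nQ a x) - Skelφ.Prm.Lp S + Skelφ.Prm.Lp S
  have := Skel.E₀_le_Frad (Skelφ.Prm.gap S) (fun _ => 0) (Skelφ.Prm.E₀ S) (nQ a x)
  omega

/-- **Linear growth of the cube radius**: `E₀ + c′·k ≤ rQ a x` for every `k ≤ nQ a x` and every `c′ ≤ gap`. [folklore] -/
theorem lin_le_rQ_T {c' : ℕ} (hgap : ∀ n, c' ≤ Skelφ.Prm.gap S n) (a : ℕ) (x : Site 2) {k : ℕ} (hk : k ≤ nQ a x) :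
    Skelφ.Prm.E₀ S + c' * k ≤ (schedOfT κ Φ t p D g f c S).rQ a x := by
  have h1 := Skelφ.Erad_linear (fun _ => 0) (Skelφ.Prm.E₀ S) hgap (nQ a x)
  have h2 : c' * k ≤ c' * nQ a x := Nat.mul_le_mul_left _ hk
  exact le_trans (by omega) (Erad_le_rQ_T κ Φ t p D g f c S a x)

end AnyBlock

/-! ## §2 At the block of record `SUS ex mx`: residual floors are floors on every radius -/

section AtSUS

variable (κ : Consts) {V : Type} [DecidableEq V] [Countable V] {G : SimpleGraph V} [G.LocallyFinite] (Φ : PlanarSkeletonFrm G) (t : V)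
  (p : unitInterval) (D : Skelφ.StepI.DataNS V) (g f : ℕ) (c : Fin 2 → ℕ) (ex mx : GSlot) (q : unitInterval)

-- (cell-free, not re-declared: `ex_le_E₀_US` of SkelFrmBChoiceRadii)

/-- **`X ≤ ex → X ≤ rQ a x`** (e.g. `Pk.r₀ ≤ R` with `R := rQ α x`: a floor `r₀ ≤ ex`). [folklore] -/
theorem le_rQ_of_le_exT {X : ℕ} (h : X ≤ ex κ Φ t p D g f) (a : ℕ) (x : Site 2) :
    X ≤ (schedOfT κ Φ t p D g f c (SUS ex mx κ Φ t p D g f q)).rQ a x :=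
  le_trans (le_trans h (ex_le_E₀_US κ Φ t p D g f ex mx q)) (E₀_le_rQ_T κ Φ t p D g f c _ a x)

/-- **`X ≤ ex → X ≤ rB a v δ`**. [folklore] -/
theorem le_rB_of_le_exT {X : ℕ} (h : X ≤ ex κ Φ t p D g f) (a : ℕ) (v : Site 2) (δ : MDir) :
    X ≤ (schedOfT κ Φ t p D g f c (SUS ex mx κ Φ t p D g f q)).rB a v δ :=
  le_trans (le_trans h (ex_le_E₀_US κ Φ t p D g f ex mx q)) (E₀_le_rB_T κ Φ t p D g f c _ a v δ)

/-- **`X + L′ ≤ ex → X ≤ rM a x`** (the arrival-box radius loses `L′`). [folklore] -/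
theorem le_rM_of_le_exT {X : ℕ} (h : X + Skelφ.Prm.Lp (SUS ex mx κ Φ t p D g f q) ≤ Skelφ.Prm.E₀ (SUS ex mx κ Φ t p D g f q)) (a : ℕ) (x : Site 2) :
    X ≤ (schedOfT κ Φ t p D g f c (SUS ex mx κ Φ t p D g f q)).rM a x := by
  have := E₀_le_rM_T κ Φ t p D g f c (SUS ex mx κ Φ t p D g f q) a x
  omega

/-- **`cOffS·k + E₀ ≤ rQ a x`** for `k ≤ nQ a x` (the column constant is below every gap, `hgapc_US`). [folklore] -/
theorem lin_le_rQ_UT (a : ℕ) (x : Site 2) {k : ℕ} (hk : k ≤ nQ a x) :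
    Skelφ.Prm.E₀ (SUS ex mx κ Φ t p D g f q) + cOffS κ Φ t p D g f * k ≤ (schedOfT κ Φ t p D g f c (SUS ex mx κ Φ t p D g f q)).rQ a x :=
  lin_le_rQ_T κ Φ t p D g f c _ (hgapc_US κ Φ t p D g f ex mx q) a x hk

/-- **THE DEPTH ROW (KGDepth's `hR`)**: at a cell `x` with `‖x‖₁ ≤ nQ a x` (run pairs), any budget `Z` with `Z + 1 ≤ ex` satisfies `(cOffS·‖x‖₁ + 1) + Z ≤ rQ a x` — the
column vertex's depth `D₀ = cOffS·‖x‖₁ + 1` (`colVT_mem_graphBall_lin`) plus the prism allowance `Z` (`:= (kq+3)·max ‖z‖₁` over p5's prism) fits in the cube radius.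
[cite: KozmaNitzan2024, §4 p. 31 (Step IV)] -/
theorem depth_row_UT (a : ℕ) (x : Site 2) (hx : (x 0).natAbs + (x 1).natAbs ≤ nQ a x) {Z : ℕ} (hZ : Z + 1 ≤ ex κ Φ t p D g f) :
    (cOffS κ Φ t p D g f * ((x 0).natAbs + (x 1).natAbs) + 1) + Z ≤ (schedOfT κ Φ t p D g f c (SUS ex mx κ Φ t p D g f q)).rQ a x := by
  have h1 := lin_le_rQ_UT κ Φ t p D g f c ex mx q a x hx
  have h2 := ex_le_E₀_US κ Φ t p D g f ex mx q
  omega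

/-- **THE SUBTRACTED ROW (KGExcess's `R₁ ≤ R − L′`)**: `X + L′ + 1 ≤ E₀ → X ≤ rQ a x − L′`; with `X := Rex …` a floor on `ex` through `E₀_SUS_eq`. [folklore] -/
theorem sub_row_UT {X : ℕ} (h : X + Skelφ.Prm.Lp (SUS ex mx κ Φ t p D g f q) + 1 ≤ Skelφ.Prm.E₀ (SUS ex mx κ Φ t p D g f q)) (a : ℕ) (x : Site 2) :
    X ≤ (schedOfT κ Φ t p D g f c (SUS ex mx κ Φ t p D g f q)).rQ a x - Skelφ.Prm.Lp (SUS ex mx κ Φ t p D g f q) := by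
  have := E₀_le_rQ_T κ Φ t p D g f c (SUS ex mx κ Φ t p D g f q) a x
  omega

end AtSUS

end NegB

end PlanarSkeletonFrm

end Summit.CriticalPhenomena.PercolationContinuityZ3.Theorems.Transplant

end
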